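import Literature.MathematicalPhysics.QuantumFieldTheory.OSRegularisedDensity
import Mathlib.MeasureTheory.Measure.Haar.Unique
import HarnessLib

/-!
# Real analyticity of the Schwinger functions (Osterwalder–Schrader II, Thm. 4.1, pointwise form)

Topic `Literature/MathematicalPhysics/QuantumFieldTheory`; sequel of `OSRegularisedDensity`.
Osterwalder–Schrader II, Theorem 4.1 (E) (Comm. Math. Phys. 42 (1975), p. 288): for a Schwinger
family with E0' (linear growth), E1 (Euclidean covariance) and E2 (reflection positivity), the
Schwinger distributions `𝔖ₙ` restricted to the time-ordered region are real analytic functions.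
This file proves the pointwise, local form: near every strictly time-ordered configuration `x`
there is a function `S`, holomorphic on a complex neighbourhood of `x`, with
`𝔖ₙ(F) = ∫ S(y) F(y) dy` for every test function `F` supported near `x`
(`schwinger_exists_holomorphic_density_near`). The proof (Method B of OS II, Ch. V.1, with the
removal of the regularisation of Ch. VI.1 by analytic deconvolution) is assembled from
`OSRegularisedDensity.exists_holomorphic_density_skelDist`:

* `exists_frame_near` — `d` linearly independent unit directions within any distance of the time
  axis (the frames `ê_μ` of OS II p. 291);
* the configuration is written `x = posAff U₀` for a base `ξ` with gap `g > 0` in every frame and a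
  parameter point `U₀` with positive directional coordinates (`exists_skeleton_data`);
* the skeleton distribution `T = 𝔖_{k+2} ∘ skelPullback` has a holomorphic density near `U₀`; the
  affine change of variables `posAff` (Haar uniqueness for its Jacobian constant,
  `exists_integral_comp_posAff`) and the complexified inverse affine map (`cplxL`) carry it to a
  holomorphic density of `𝔖_{k+2}` near `x`;
* the local densities patch (`eqOn_of_forall_integral_mul_eq`: continuous densities of the same
  distribution agree) to **one function `S`, continuous on the ordered region and locally the
  restriction of holomorphic functions, with `𝔖_{k+2}(F) = ∫ S F` for `F` supported in the charts**
  (`schwinger_exists_realAnalytic_density`) — Theorem 4.1 (E) as printed ("`S_k(ξ)` are real analytic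
  functions on the time-ordered region"); `schwinger_exists_holomorphic_density_near_of_isOSFamily`
  restates the local form for an OS family with E0'.

## References

* K. Osterwalder, R. Schrader, *Axioms for Euclidean Green's functions II*, Comm. Math. Phys.
  42 (1975) 281–305, Thm. 4.1, Ch. V.1, Ch. VI.1. [OsterwalderSchraderCMP1975]
-/

noncomputable section

open MeasureTheory Set Filter Module Metric
open _root_.Topology
open scoped InnerProductSpace RealInnerProductSpace SchwartzMap NNReal Real ENNReal

namespace Literature.MathematicalPhysics.QuantumFieldTheory

open Literature.MathematicalPhysics.QuantumLattice (SchwingerFamily IsPositiveTimeMulti schwartzNorm)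
open Literature.MathematicalPhysics.QuantumLattice.SchwingerFamily
open Literature.Analysis.FunctionSpaces.SchwartzAverage
open Literature.Analysis.Distribution
open Literature.Analysis.Complex
open OSFrames

variable {d : ℕ}

/-! ### Frames near the time axis -/

section Frames

variable [NeZero d]

/-- **Frames near the time axis**: for every `c > 0` there are `d` linearly independent unit vectors
within distance `c` of the time axis (normalise `e₀ + ε e_μ`). [cite: OsterwalderSchraderCMP1975, Ch. V.1 p. 291] -/
theorem exists_frame_near {c : ℝ} (hc : 0 < c) :
    ∃ ê : Fin d → EuclideanSpace ℝ (Fin d), LinearIndependent ℝ ê ∧ (∀ μ, ‖ê μ‖ = 1) ∧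
      ∀ μ, ‖ê μ - timeAxis‖ < c := by
  set ε : ℝ := min (c / 3) (1 / 2) with hε
  have hε0 : 0 < ε := lt_min (by positivity) (by norm_num)
  have hεc : 3 * ε ≤ c := by
    have := min_le_left (c / 3) (1 / 2); linarith
  have hε1 : ε ≤ 1 / 2 := min_le_right _ _
  set v : Fin d → EuclideanSpace ℝ (Fin d) := fun μ => timeAxis + ε • EuclideanSpace.single μ (1 : ℝ) with hv
  have hv_sub : ∀ μ, ‖v μ - timeAxis‖ = ε := fun μ => by
    simp only [hv, add_sub_cancel_left, norm_smul, PiLp.norm_single, norm_one, mul_one,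
      Real.norm_eq_abs, abs_of_pos hε0]
  have hv_norm : ∀ μ, 1 - ε ≤ ‖v μ‖ := fun μ => by
    have h := norm_sub_norm_le (timeAxis : EuclideanSpace ℝ (Fin d)) (v μ)
    rw [norm_timeAxis, norm_sub_rev, hv_sub] at h
    linarith
  have hv_pos : ∀ μ, 0 < ‖v μ‖ := fun μ => by linarith [hv_norm μ]
  -- linear independence of `v`
  have hli : LinearIndependent ℝ v := by
    refine Fintype.linearIndependent_iff.2 fun g hg => ?_
    have key : ∀ ν : Fin d, (if ν = 0 then ∑ μ, g μ else 0) + ε * g ν = 0 := by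
      intro ν
      have h := congrArg (fun w : EuclideanSpace ℝ (Fin d) => ⟪EuclideanSpace.single ν (1 : ℝ), w⟫) hg
      simp only [inner_zero_right, inner_sum, inner_smul_right, hv, inner_add_right,
        EuclideanSpace.inner_single_left, map_one, one_mul, timeAxis, PiLp.single_apply] at h
      by_cases hν : ν = 0
      · subst hν
        simp only [if_true, mul_add, mul_one, mul_ite, mul_zero, Finset.sum_add_distrib,
          Finset.sum_ite_eq, Finset.mem_univ, if_true] at h
        simp only [if_true]
        linarith [h]
      · simp only [hν, if_false, zero_add, mul_ite, mul_one, mul_zero, Finset.sum_ite_eq,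
          Finset.mem_univ, if_true] at h
        simp only [hν, if_false, zero_add]
        linarith [h]
    have hrest : ∀ ν : Fin d, ν ≠ 0 → g ν = 0 := fun ν hν => by
      have h := key ν
      rw [if_neg hν, zero_add] at h
      exact (mul_eq_zero.1 h).resolve_left hε0.ne'
    have hsum : ∑ μ, g μ = g 0 := by
      rw [Finset.sum_eq_single_of_mem (0 : Fin d) (Finset.mem_univ _) fun μ _ hμ => hrest μ hμ]
    have h0 : g 0 = 0 := by
      have h := key 0
      rw [if_pos rfl, hsum] at h
      nlinarith
    intro ν
    by_cases hν : ν = 0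
    · rw [hν]; exact h0
    · exact hrest ν hν
  -- normalisation
  refine ⟨fun μ => (‖v μ‖)⁻¹ • v μ, ?_, fun μ => ?_, fun μ => ?_⟩
  · have h := hli.units_smul fun μ => Units.mk0 (‖v μ‖)⁻¹ (inv_ne_zero (hv_pos μ).ne')
    convert h using 1
    exact funext fun μ => by simp [Units.smul_def]
  · rw [norm_smul, norm_inv, norm_norm, inv_mul_cancel₀ (hv_pos μ).ne']
  · have h1 : ‖(‖v μ‖)⁻¹ • v μ - v μ‖ ≤ ε := by
      rw [show (‖v μ‖)⁻¹ • v μ - v μ = ((‖v μ‖)⁻¹ - 1) • v μ by rw [sub_smul, one_smul], norm_smul,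
        Real.norm_eq_abs]
      have h2 : |(‖v μ‖)⁻¹ - 1| * ‖v μ‖ = |1 - ‖v μ‖| := by
        rw [show (‖v μ‖)⁻¹ - 1 = (1 - ‖v μ‖) * (‖v μ‖)⁻¹ by
          rw [sub_mul, one_mul, mul_inv_cancel₀ (hv_pos μ).ne'], abs_mul, abs_inv, abs_norm,
          mul_assoc, inv_mul_cancel₀ (hv_pos μ).ne', mul_one]
      rw [h2]
      have h3 : |‖v μ‖ - ‖(timeAxis : EuclideanSpace ℝ (Fin d))‖| ≤ ‖v μ - timeAxis‖ := abs_norm_sub_norm_le _ _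
      rw [norm_timeAxis, hv_sub, abs_sub_comm] at h3
      exact h3
    calc ‖(‖v μ‖)⁻¹ • v μ - timeAxis‖ ≤ ‖(‖v μ‖)⁻¹ • v μ - v μ‖ + ‖v μ - timeAxis‖ := norm_sub_le_norm_sub_add_norm_sub _ _ _
      _ ≤ ε + ε := add_le_add h1 (hv_sub μ).le
      _ < c := by linarith

end Frames

/-! ### Complex configuration points and complexified linear maps -/

section Cplx

variable {n : ℕ}

/-- The complex point of a real configuration: `(cfgPt y) j μ = y j μ`. [folklore] -/
def cfgPt (y : Fin n → EuclideanSpace ℝ (Fin d)) : Fin n → Fin d → ℂ := fun j μ => ((y j μ : ℝ) : ℂ)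

/-- Coordinates of the complex point. [folklore] -/
@[simp]
theorem cfgPt_apply (y : Fin n → EuclideanSpace ℝ (Fin d)) (j : Fin n) (μ : Fin d) : cfgPt y j μ = ((y j μ : ℝ) : ℂ) := rfl

/-- `cfgPt` is subtractive. [folklore] -/
theorem cfgPt_sub (y y' : Fin n → EuclideanSpace ℝ (Fin d)) : cfgPt (y - y') = cfgPt y - cfgPt y' := by
  funext j μ; simp [cfgPt]

/-- `cfgPt` is `1`-Lipschitz from the configuration norm to the sup norm. [folklore] -/
theorem norm_cfgPt_le (y : Fin n → EuclideanSpace ℝ (Fin d)) : ‖cfgPt y‖ ≤ ‖y‖ := by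
  refine (pi_norm_le_iff_of_nonneg (norm_nonneg _)).2 fun j => (pi_norm_le_iff_of_nonneg (norm_nonneg _)).2 fun μ => ?_
  rw [cfgPt_apply, Complex.norm_real]
  exact (PiLp.norm_apply_le (y j) μ).trans (norm_le_pi_norm y j)

/-- Real balls go into complex balls. [folklore] -/
theorem cfgPt_mem_ball {x y : Fin n → EuclideanSpace ℝ (Fin d)} {ρ : ℝ} (h : y ∈ Metric.ball x ρ) :
    cfgPt y ∈ ball (cfgPt x) ρ := by
  rw [mem_ball, dist_eq_norm] at h ⊢
  rw [← cfgPt_sub]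
  exact lt_of_le_of_lt (norm_cfgPt_le _) h

/-- `cfgPt` is continuous. [folklore] -/
theorem continuous_cfgPt : Continuous (cfgPt (n := n) (d := d)) :=
  continuous_pi fun j => continuous_pi fun μ =>
    Complex.continuous_ofReal.comp ((PiLp.continuous_apply 2 _ μ).comp (continuous_apply j))

/-- The coordinate configurations `cfgUnit j μ = (0, …, e_μ, …, 0)` (`e_μ` at the point `j`). [folklore] -/
def cfgUnit (j : Fin n) (μ : Fin d) : Fin n → EuclideanSpace ℝ (Fin d) := Pi.single j (EuclideanSpace.single μ (1 : ℝ))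

/-- **Expansion of a configuration in the coordinate configurations.** [folklore] -/
theorem sum_cfgUnit (y : Fin n → EuclideanSpace ℝ (Fin d)) : ∑ j, ∑ μ, y j μ • cfgUnit j μ = y := by
  funext j'
  simp only [Finset.sum_apply, cfgUnit, Pi.smul_apply, Pi.single_apply, smul_ite, smul_zero]
  rw [Finset.sum_comm]
  simp only [Finset.sum_ite_eq, Finset.mem_univ, if_true]
  have h := (EuclideanSpace.basisFun (Fin d) ℝ).sum_repr (y j')
  simpa using h

variable {ι' : Type*} [Fintype ι']

/-- **The complexification of a real linear map** from configurations to a Euclidean parameter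
space, in coordinates: `(cplxL L ζ) p = ∑_{j, μ} L(cfgUnit j μ)_p ζ_{j μ}`. [folklore] -/
def cplxL (L : (Fin n → EuclideanSpace ℝ (Fin d)) →L[ℝ] EuclideanSpace ℝ ι') (ζ : Fin n → Fin d → ℂ) : ι' → ℂ :=
  fun p => ∑ j, ∑ μ, ((L (cfgUnit j μ) p : ℝ) : ℂ) * ζ j μ

omit [Fintype ι'] in
/-- **The complexification extends the real map**: `cplxL L (cfgPt y) = eRealPt (L y)`. [folklore] -/
theorem cplxL_cfgPt [Fintype ι'] (L : (Fin n → EuclideanSpace ℝ (Fin d)) →L[ℝ] EuclideanSpace ℝ ι')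
    (y : Fin n → EuclideanSpace ℝ (Fin d)) : cplxL L (cfgPt y) = eRealPt (L y) := by
  funext p
  conv_rhs => rw [← sum_cfgUnit y]
  simp only [cplxL, cfgPt_apply, eRealPt_apply, map_sum, map_smul, WithLp.ofLp_sum, WithLp.ofLp_smul,
    Finset.sum_apply, Pi.smul_apply, smul_eq_mul, Complex.ofReal_sum, Complex.ofReal_mul]
  refine Finset.sum_congr rfl fun j _ => Finset.sum_congr rfl fun μ _ => ?_
  ring

omit [Fintype ι'] in
/-- The complexification is subtractive. [folklore] -/
theorem cplxL_sub (L : (Fin n → EuclideanSpace ℝ (Fin d)) →L[ℝ] EuclideanSpace ℝ ι') (ζ ζ' : Fin n → Fin d → ℂ) :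
    cplxL L (ζ - ζ') = cplxL L ζ - cplxL L ζ' := by
  funext p
  simp only [cplxL, Pi.sub_apply, mul_sub, Finset.sum_sub_distrib]

/-- The operator bound of the complexification (sup norms): `∑_{j, μ} ‖L (cfgUnit j μ)‖`. [folklore] -/
def cplxLBound (L : (Fin n → EuclideanSpace ℝ (Fin d)) →L[ℝ] EuclideanSpace ℝ ι') : ℝ :=
  ∑ j, ∑ μ, ‖L (cfgUnit j μ)‖

/-- `cplxLBound ≥ 0`. [folklore] -/
theorem cplxLBound_nonneg (L : (Fin n → EuclideanSpace ℝ (Fin d)) →L[ℝ] EuclideanSpace ℝ ι') :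
    0 ≤ cplxLBound L :=
  Finset.sum_nonneg fun _ _ => Finset.sum_nonneg fun _ _ => norm_nonneg _

/-- **The complexification is bounded**: `‖cplxL L ζ‖ ≤ cplxLBound L · ‖ζ‖`. [folklore] -/
theorem norm_cplxL_le (L : (Fin n → EuclideanSpace ℝ (Fin d)) →L[ℝ] EuclideanSpace ℝ ι') (ζ : Fin n → Fin d → ℂ) :
    ‖cplxL L ζ‖ ≤ cplxLBound L * ‖ζ‖ := by
  refine (pi_norm_le_iff_of_nonneg (mul_nonneg (cplxLBound_nonneg L) (norm_nonneg _))).2 fun p => ?_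
  simp only [cplxL, cplxLBound, Finset.sum_mul]
  refine (norm_sum_le _ _).trans (Finset.sum_le_sum fun j _ => (norm_sum_le _ _).trans (Finset.sum_le_sum fun μ _ => ?_))
  rw [norm_mul, Complex.norm_real]
  refine mul_le_mul ?_ ((norm_le_pi_norm (ζ j) μ).trans (norm_le_pi_norm ζ j)) (norm_nonneg _) (norm_nonneg _)
  have h := PiLp.norm_apply_le (L (cfgUnit j μ)) p
  simpa using h

/-- The complexification maps balls into balls. [folklore] -/
theorem cplxL_mem_ball (L : (Fin n → EuclideanSpace ℝ (Fin d)) →L[ℝ] EuclideanSpace ℝ ι') {ζ₀ ζ : Fin n → Fin d → ℂ}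
    {ρ ρ' : ℝ} (hζ : ζ ∈ ball ζ₀ ρ) (hρ : cplxLBound L * ρ < ρ') (c : Fin n → Fin d → ℂ) :
    cplxL L (ζ - c) ∈ ball (cplxL L (ζ₀ - c)) ρ' := by
  rw [mem_ball, dist_eq_norm] at hζ ⊢
  rw [← cplxL_sub, sub_sub_sub_cancel_right]
  refine lt_of_le_of_lt ((norm_cplxL_le L _).trans (mul_le_mul_of_nonneg_left hζ.le (cplxLBound_nonneg L))) hρ

omit [Fintype ι'] in
/-- **The complexification is holomorphic** (it is `ℂ`-linear in coordinates). [folklore] -/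
theorem differentiable_cplxL [Fintype ι'] (L : (Fin n → EuclideanSpace ℝ (Fin d)) →L[ℝ] EuclideanSpace ℝ ι')
    (c : Fin n → Fin d → ℂ) : Differentiable ℂ fun ζ => cplxL L (ζ - c) := by
  refine differentiable_pi.2 fun p => ?_
  simp only [cplxL, Pi.sub_apply]
  refine Differentiable.fun_sum fun j _ => Differentiable.fun_sum fun μ _ => (differentiable_const _).mul ?_
  have h1 : Differentiable ℂ (fun ζ : Fin n → Fin d → ℂ => ζ j) := differentiable_pi.1 differentiable_id j
  have h2 : Differentiable ℂ (fun ζ : Fin n → Fin d → ℂ => ζ j μ) := differentiable_pi.1 h1 μ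
  exact h2.sub (differentiable_const _)

end Cplx

/-! ### The affine change of variables and the pushforward of test functions -/

section Push

variable {k : ℕ} (ξ : Fin (k + 1) → EuclideanSpace ℝ (Fin d)) (ê : Fin d → EuclideanSpace ℝ (Fin d))
  (hli : LinearIndependent ℝ ê)

/-- **The Jacobian constant of the affine position map**: there is `c > 0` with
`∫ Φ(posAff U) dU = c ∫ Φ(y) dy` for every `Φ` (Haar uniqueness for the linear part, translation
invariance for the base point). [folklore] -/
theorem exists_integral_comp_posAff :
    ∃ c : ℝ, 0 < c ∧ ∀ Φ : (Fin (k + 2) → EuclideanSpace ℝ (Fin d)) → ℂ,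
      ∫ U, Φ (posAff ξ ê hli U) = (c : ℂ) * ∫ y, Φ y := by
  set Lf := posLinCLE (k := k) ê hli with hLf
  obtain ⟨c₁, c₁_pos, c₁_fin, h₁⟩ : ∃ c₁ : ℝ≥0∞, c₁ ≠ 0 ∧ c₁ ≠ ∞ ∧
      (volume : Measure (EuclideanSpace ℝ (Fin (k + 2) × Fin d))).map Lf =
        c₁ • (volume : Measure (Fin (k + 2) → EuclideanSpace ℝ (Fin d))) := by
    have : Measure.IsAddHaarMeasure ((volume : Measure (EuclideanSpace ℝ (Fin (k + 2) × Fin d))).map Lf) :=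
      Lf.isAddHaarMeasure_map volume
    refine ⟨Measure.addHaarScalarFactor ((volume : Measure (EuclideanSpace ℝ (Fin (k + 2) × Fin d))).map Lf) volume, ?_,
      ENNReal.coe_ne_top, Measure.isAddLeftInvariant_eq_smul _ _⟩
    simpa only [ne_eq, ENNReal.coe_eq_zero] using
      (Measure.addHaarScalarFactor_pos_of_isAddHaarMeasure
        ((volume : Measure (EuclideanSpace ℝ (Fin (k + 2) × Fin d))).map Lf) volume).ne'
  refine ⟨c₁.toReal, ENNReal.toReal_pos c₁_pos c₁_fin, fun Φ => ?_⟩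
  have hmap : ∫ y, Φ (pbase ξ + y) ∂((volume : Measure (EuclideanSpace ℝ (Fin (k + 2) × Fin d))).map Lf) =
      ∫ U, Φ (pbase ξ + Lf U) :=
    Lf.toHomeomorph.measurableEmbedding.integral_map _
  calc ∫ U, Φ (posAff ξ ê hli U) = ∫ U, Φ (pbase ξ + Lf U) := rfl
    _ = ∫ y, Φ (pbase ξ + y) ∂((volume : Measure (EuclideanSpace ℝ (Fin (k + 2) × Fin d))).map Lf) := hmap.symm
    _ = (c₁.toReal : ℂ) * ∫ y, Φ (pbase ξ + y) := by
        rw [h₁, integral_smul_measure, Complex.real_smul]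
    _ = (c₁.toReal : ℂ) * ∫ y, Φ y := by rw [integral_add_left_eq_self]

/-- **The pushforward of a test function** `F ↦ F ∘ posAff` (`𝓢((ℝ^d)^{k+2}) → 𝓢(ℝ^{(k+2)d})`), a
right inverse of `skelPullback`. [folklore] -/
def skelPush (F : 𝓢((Fin (k + 2) → EuclideanSpace ℝ (Fin d)), ℂ)) : 𝓢(EuclideanSpace ℝ (Fin (k + 2) × Fin d), ℂ) :=
  SchwartzMap.compCLMOfContinuousLinearEquiv ℂ (posLinCLE ê hli) (SchwartzMap.compSubConstCLM ℂ (-pbase ξ) F)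

/-- Values of the pushforward: `(skelPush F)(U) = F (posAff U)`. [folklore] -/
@[simp]
theorem skelPush_apply (F : 𝓢((Fin (k + 2) → EuclideanSpace ℝ (Fin d)), ℂ)) (U : EuclideanSpace ℝ (Fin (k + 2) × Fin d)) :
    skelPush ξ ê hli F U = F (posAff ξ ê hli U) := by
  simp [skelPush, posAff, sub_neg_eq_add, add_comm]

/-- `skelPullback ∘ skelPush = id`. [folklore] -/
theorem skelPullback_skelPush (F : 𝓢((Fin (k + 2) → EuclideanSpace ℝ (Fin d)), ℂ)) :
    skelPullback ξ ê hli (skelPush ξ ê hli F) = F := by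
  ext y
  rw [skelPullback_apply, skelPush_apply, posAff, ContinuousLinearEquiv.apply_symm_apply, add_sub_cancel]

/-- **The Schwinger function is the skeleton distribution of the pushforward**:
`𝔖_{k+2}(F) = T(F ∘ posAff)`. [folklore] -/
theorem schwinger_eq_skelDist_skelPush (𝔖 : SchwingerFamily (EuclideanSpace ℝ (Fin d)))
    (F : 𝓢((Fin (k + 2) → EuclideanSpace ℝ (Fin d)), ℂ)) :
    𝔖 (k + 2) F = skelDist 𝔖 ξ ê hli (skelPush ξ ê hli F) := by
  rw [skelDist_apply, skelPullback_skelPush]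

/-- **Supports of pushforwards**: if `F` is supported in `B(x, ρ)` and `posAff U₀ = x`, then
`F ∘ posAff` is supported in `B̄(U₀, ‖posLin⁻¹‖ ρ)`. [folklore] -/
theorem tsupport_skelPush_subset {F : 𝓢((Fin (k + 2) → EuclideanSpace ℝ (Fin d)), ℂ)}
    {x : Fin (k + 2) → EuclideanSpace ℝ (Fin d)} {ρ : ℝ}
    (hF : tsupport (F : (Fin (k + 2) → EuclideanSpace ℝ (Fin d)) → ℂ) ⊆ Metric.ball x ρ)
    {U₀ : EuclideanSpace ℝ (Fin (k + 2) × Fin d)} (hU₀ : posAff ξ ê hli U₀ = x) :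
    tsupport (skelPush ξ ê hli F : EuclideanSpace ℝ (Fin (k + 2) × Fin d) → ℂ) ⊆
      closedBall U₀ (‖((posLinCLE (k := k) ê hli).symm).toContinuousLinearMap‖ * ρ) := by
  refine closure_minimal (fun U hU => ?_) isClosed_closedBall
  rw [Function.mem_support, skelPush_apply] at hU
  have hy : posAff ξ ê hli U ∈ Metric.ball x ρ := hF (subset_tsupport _ (Function.mem_support.2 hU))
  have hUU : U - U₀ = (posLinCLE ê hli).symm (posAff ξ ê hli U - posAff ξ ê hli U₀) := by
    simp only [posAff, add_sub_add_left_eq_sub, map_sub, ContinuousLinearEquiv.symm_apply_apply]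
  rw [mem_closedBall, dist_eq_norm, hUU]
  refine (((posLinCLE ê hli).symm).toContinuousLinearMap.le_opNorm _).trans
    (mul_le_mul_of_nonneg_left ?_ (norm_nonneg _))
  rw [hU₀]
  exact (mem_ball_iff_norm.1 hy).le

end Push

/-! ### Skeleton data for a strictly time-ordered configuration -/

section Data

variable [NeZero d] {k : ℕ}

omit [NeZero d] in
/-- Telescoping: `∑_{i<j} (x_{i+1} − x_i) = x_j − x_0`. [folklore] -/
theorem sum_filter_succ_sub_castSucc (x : Fin (k + 2) → EuclideanSpace ℝ (Fin d)) (j : Fin (k + 2)) :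
    ∑ i ∈ Finset.univ.filter (fun i : Fin (k + 1) => i.val < j.val), (x i.succ - x (Fin.castSucc i)) = x j - x 0 := by
  rw [← partialSum_eq_sum_filter]
  have h := congr_fun (Fin.partialSum_left_neg x) j
  rw [Pi.vadd_apply, vadd_eq_add] at h
  rw [show (fun i : Fin (k + 1) => x i.succ - x (Fin.castSucc i)) = fun i => -x (Fin.castSucc i) + x i.succ from
    funext fun i => sub_eq_neg_add _ _]
  exact eq_sub_of_add_eq' h

/-- **Skeleton data for a strictly time-ordered configuration** (OS II, Ch. V.1 p. 291: the frames
`ê_μ` near the time axis, a base with a gap `g > 0` in every frame, and positive directional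
coordinates): for `x` with `x⁰_0 < x⁰_1 < ⋯ < x⁰_{k+1}` there are linearly independent unit
directions `ê` seeing each other at nonnegative times, a base `ξ` with `⟪ê_μ, ξᵢ⟫ ≥ g > 0`, and a
parameter point `U₀` with all directional coordinates equal to some `t > 0` and `posAff U₀ = x`. [cite: OsterwalderSchraderCMP1975, Ch. V.1 p. 291] -/
theorem exists_skeleton_data (x : Fin (k + 2) → EuclideanSpace ℝ (Fin d))
    (hx : ∀ i : Fin (k + 1), x (Fin.castSucc i) 0 < x i.succ 0) :
    ∃ (ê : Fin d → EuclideanSpace ℝ (Fin d)) (hli : LinearIndependent ℝ ê) (ξ : Fin (k + 1) → EuclideanSpace ℝ (Fin d))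
      (g t : ℝ) (U₀ : EuclideanSpace ℝ (Fin (k + 2) × Fin d)),
      (∀ μ, ‖ê μ‖ = 1) ∧ (∀ μ ν, 0 ≤ ⟪ê μ, ê ν⟫) ∧ (∀ μ i, g ≤ ⟪ê μ, ξ i⟫) ∧ 0 < g ∧ 0 < t ∧
        posAff ξ ê hli U₀ = x ∧ ∀ j, tailR U₀ j = t := by
  -- the differences and the cone constant
  set η : Fin (k + 1) → EuclideanSpace ℝ (Fin d) := fun i => x i.succ - x (Fin.castSucc i) with hη
  have hη0 : ∀ i, 0 < η i 0 := fun i => by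
    simp only [hη, PiLp.sub_apply]; linarith [hx i]
  set cI : Fin (k + 1) → ℝ := fun i => η i 0 / (2 * (‖η i‖ + 1)) with hcI
  have hcI0 : ∀ i, 0 < cI i := fun i => by have := hη0 i; positivity
  set c : ℝ := min (1 / 2) (Finset.univ.inf' Finset.univ_nonempty cI) with hc
  have hc0 : 0 < c := lt_min (by norm_num) ((Finset.lt_inf'_iff _).2 fun i _ => hcI0 i)
  have hc_half : c ≤ 1 / 2 := min_le_left _ _
  have hc_cone : ∀ i, c * ‖η i‖ < η i 0 := fun i => by
    have h1 : c ≤ cI i := (min_le_right _ _).trans (Finset.inf'_le _ (Finset.mem_univ i))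
    have h2 : cI i * ‖η i‖ < η i 0 := by
      simp only [hcI]
      rw [div_mul_eq_mul_div, div_lt_iff₀ (by positivity)]
      nlinarith [norm_nonneg (η i), hη0 i]
    nlinarith [norm_nonneg (η i)]
  -- the frame
  obtain ⟨ê, hli, hê1, hnear⟩ := exists_frame_near (d := d) hc0
  have hêê : ∀ μ ν, 0 ≤ ⟪ê μ, ê ν⟫ := fun μ ν =>
    (inner_pos_of_near ((hnear μ).trans_le hc_half) ((hnear ν).trans_le hc_half) (hê1 ν)).le
  have hpos : ∀ μ i, 0 < ⟪ê μ, η i⟫ := fun μ i => inner_pos_of_cone (hnear μ) (hc_cone i)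
  -- the gap
  set m₀ : ℝ := (Finset.univ : Finset (Fin d × Fin (k + 1))).inf' Finset.univ_nonempty fun q => ⟪ê q.1, η q.2⟫ with hm₀
  have hm₀0 : 0 < m₀ := (Finset.lt_inf'_iff _).2 fun q _ => hpos q.1 q.2
  have hm₀le : ∀ μ i, m₀ ≤ ⟪ê μ, η i⟫ := fun μ i =>
    Finset.inf'_le (fun q : Fin d × Fin (k + 1) => ⟪ê q.1, η q.2⟫) (Finset.mem_univ (μ, i))
  set t : ℝ := m₀ / (2 * (d + 1)) with ht
  have ht0 : 0 < t := by positivity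
  set ξ : Fin (k + 1) → EuclideanSpace ℝ (Fin d) := fun i => η i - t • ∑ ν, ê ν with hξ
  have hgap : ∀ μ i, m₀ / 2 ≤ ⟪ê μ, ξ i⟫ := fun μ i => by
    have h1 : ⟪ê μ, ∑ ν, ê ν⟫ ≤ d := by
      rw [inner_sum]
      calc ∑ ν, ⟪ê μ, ê ν⟫ ≤ ∑ _ν : Fin d, (1 : ℝ) := Finset.sum_le_sum fun ν _ => by
            have := real_inner_le_norm (ê μ) (ê ν); rw [hê1, hê1, one_mul] at this; exact this
        _ = d := by simp
    have h2 : ⟪ê μ, ξ i⟫ = ⟪ê μ, η i⟫ - t * ⟪ê μ, ∑ ν, ê ν⟫ := by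
      simp only [hξ, inner_sub_right, inner_smul_right]
    rw [h2]
    have h3 := hm₀le μ i
    have h4 : t * ⟪ê μ, ∑ ν, ê ν⟫ ≤ t * d := mul_le_mul_of_nonneg_left h1 ht0.le
    have h5 : t * d ≤ m₀ / 2 := by
      rw [ht, div_mul_eq_mul_div, div_le_div_iff₀ (by positivity) (by positivity)]
      nlinarith
    linarith
  -- the parameter point
  set U₀ : EuclideanSpace ℝ (Fin (k + 2) × Fin d) := WithLp.toLp 2 fun p =>
    Fin.cases (motive := fun _ => ℝ) ((dirBasis ê hli).repr (x 0) p.2) (fun _ => t) p.1 with hU₀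
  have hU₀_zero : ∀ μ, U₀ (0, μ) = (dirBasis ê hli).repr (x 0) μ := fun μ => by simp [hU₀]
  have hU₀_succ : ∀ (i : Fin (k + 1)) μ, U₀ (i.succ, μ) = t := fun i μ => by simp [hU₀]
  have htail : tailBlocks U₀ = fun _ => t := funext fun p => hU₀_succ p.1 p.2
  refine ⟨ê, hli, ξ, m₀ / 2, t, U₀, hê1, hêê, hgap, by positivity, ht0, ?_, fun j => hU₀_succ _ _⟩
  -- `posAff U₀ = x`
  funext j
  rw [posAff_eq_posV, htail]
  have hdir : dirMap ê hli (fun μ => U₀ (0, μ)) = x 0 := by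
    simp_rw [hU₀_zero]
    rw [dirMap_apply]
    conv_rhs => rw [← (dirBasis ê hli).sum_repr (x 0)]
    simp
  have hdiff : ∀ i, dirDiff ξ ê (fun _ => t) i = η i := fun i => by
    simp only [dirDiff, hξ, Finset.smul_sum]
    abel
  rw [hdir, posV]
  simp_rw [hdiff]
  rw [sum_filter_succ_sub_castSucc]
  abel

end Data

/-! ### Osterwalder–Schrader II, Theorem 4.1 (pointwise) -/

section Main

variable [NeZero d] (𝔖 : SchwingerFamily (EuclideanSpace ℝ (Fin d))) (hE1 : 𝔖.IsEuclideanCovariant)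
  (hE2 : 𝔖.IsOSReflectionPositive) (hE0 : 𝔖.HasLinearGrowth) {k : ℕ}

include hE1 hE2 hE0

/-- **Osterwalder–Schrader II, Theorem 4.1 (E), pointwise form: the Schwinger functions are real
analytic in the time-ordered region.** For a Schwinger family with E0' (linear growth), E1 and E2
and a configuration `x = (x_0, …, x_{k+1})` with `x⁰_0 < x⁰_1 < ⋯ < x⁰_{k+1}` there are `ρ > 0` and
a function `S`, holomorphic and bounded on the complex sup-ball of radius `ρ` about `x`, such that
`𝔖_{k+2}(F) = ∫ S(y) F(y) dy` for every test function `F` supported in the real ball `B(x, ρ)`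
(Method B of OS II Ch. V.1 for the skeleton and the removal of the regularisation of Ch. VI.1, here
by analytic deconvolution). [cite: OsterwalderSchraderCMP1975, Thm. 4.1; Ch. V.1 (5.6)–(5.8); Ch. VI.1 (6.5)–(6.13)] -/
theorem schwinger_exists_holomorphic_density_near (x : Fin (k + 2) → EuclideanSpace ℝ (Fin d))
    (hx : ∀ i : Fin (k + 1), x (Fin.castSucc i) 0 < x i.succ 0) :
    ∃ ρ : ℝ, 0 < ρ ∧ ∃ S : (Fin (k + 2) → Fin d → ℂ) → ℂ,
      DifferentiableOn ℂ S (ball (cfgPt x) ρ) ∧ (∃ B : ℝ, ∀ ζ ∈ ball (cfgPt x) ρ, ‖S ζ‖ ≤ B) ∧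
      ∀ F : 𝓢((Fin (k + 2) → EuclideanSpace ℝ (Fin d)), ℂ),
        tsupport (F : (Fin (k + 2) → EuclideanSpace ℝ (Fin d)) → ℂ) ⊆ Metric.ball x ρ →
          𝔖 (k + 2) F = ∫ y, S (cfgPt y) * F y := by
  obtain ⟨ê, hli, ξ, g, t, U₀, hê1, hêê, hξ, hg0, ht, hU₀, htail⟩ := exists_skeleton_data x hx
  -- the radius in parameter space
  have hα0 : 0 < π / (4 * (slotK k d + 1)) := by positivity
  have hα1 : π / (4 * (slotK k d + 1)) ≤ 1 := by
    rw [div_le_one (by positivity)]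
    have h1 : (1 : ℝ) ≤ slotK k d + 1 := by simp
    nlinarith [Real.pi_le_four]
  have hsin0 : 0 < Real.sin (π / (4 * (slotK k d + 1))) :=
    Real.sin_pos_of_pos_of_lt_pi hα0 (hα1.trans_lt (by linarith [Real.two_le_pi]))
  set r : ℝ := t * Real.sin (π / (4 * (slotK k d + 1))) with hr
  have hr0 : 0 < r := mul_pos ht hsin0
  obtain ⟨H, hH, ⟨B, hB⟩, hHT⟩ := exists_holomorphic_density_skelDist 𝔖 hE1 hE2 hE0 ξ ê hli hê1 hêê hξ
    (show 2 * (g / 4) < g by linarith) (show 0 < g / 4 by positivity) U₀ hr0 (fun j => by rw [htail j])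
  obtain ⟨c, hc, hcv⟩ := exists_integral_comp_posAff ξ ê hli
  -- the inverse linear map, its complexification and the radius in configuration space
  set L : (Fin (k + 2) → EuclideanSpace ℝ (Fin d)) →L[ℝ] EuclideanSpace ℝ (Fin (k + 2) × Fin d) :=
    ((posLinCLE (k := k) ê hli).symm).toContinuousLinearMap with hL
  have hLx : L (x - pbase ξ) = U₀ := by
    rw [hL, ← hU₀, posAff, add_sub_cancel_left]
    exact (posLinCLE ê hli).symm_apply_apply U₀
  set ρ : ℝ := r / (2 * (max ‖L‖ (cplxLBound L) + 1)) with hρ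
  have hM0 : 0 ≤ max ‖L‖ (cplxLBound L) := le_max_of_le_left (norm_nonneg _)
  have hρ0 : 0 < ρ := by positivity
  have hρN : ‖L‖ * ρ < r / 2 := by
    have h1 : ‖L‖ * ρ ≤ max ‖L‖ (cplxLBound L) * ρ := mul_le_mul_of_nonneg_right (le_max_left _ _) hρ0.le
    have h2 : max ‖L‖ (cplxLBound L) * ρ < r / 2 := by
      rw [hρ, mul_div_assoc', div_lt_div_iff₀ (by positivity) (by positivity)]
      nlinarith
    linarith
  have hρA : cplxLBound L * ρ < r / 2 := by
    have h1 : cplxLBound L * ρ ≤ max ‖L‖ (cplxLBound L) * ρ := mul_le_mul_of_nonneg_right (le_max_right _ _) hρ0.le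
    have h2 : max ‖L‖ (cplxLBound L) * ρ < r / 2 := by
      rw [hρ, mul_div_assoc', div_lt_div_iff₀ (by positivity) (by positivity)]
      nlinarith
    linarith
  -- the complexified inverse affine map sends the ball about `x` into the ball about `U₀`
  have hcentre : cplxL L (cfgPt x - cfgPt (pbase ξ)) = eRealPt U₀ := by
    rw [← cfgPt_sub, cplxL_cfgPt, hLx]
  have hmaps : MapsTo (fun ζ => cplxL L (ζ - cfgPt (pbase ξ))) (ball (cfgPt x) ρ) (ball (eRealPt U₀) (r / 2)) :=
    fun ζ hζ => by rw [← hcentre]; exact cplxL_mem_ball L hζ hρA _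
  refine ⟨ρ, hρ0, fun ζ => (c : ℂ) * H (cplxL L (ζ - cfgPt (pbase ξ))), ?_, ⟨c * B, fun ζ hζ => ?_⟩, fun F hF => ?_⟩
  · -- holomorphy
    exact (differentiableOn_const _).mul (hH.comp (differentiable_cplxL L _).differentiableOn hmaps)
  · -- bound
    rw [norm_mul, Complex.norm_real, Real.norm_eq_abs, abs_of_pos hc]
    exact mul_le_mul_of_nonneg_left (hB _ (hmaps hζ)) hc.le
  · -- representation
    have hsupp : tsupport (skelPush ξ ê hli F : EuclideanSpace ℝ (Fin (k + 2) × Fin d) → ℂ) ⊆ Metric.ball U₀ (r / 2) :=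
      (tsupport_skelPush_subset ξ ê hli hF hU₀).trans (closedBall_subset_ball hρN)
    rw [schwinger_eq_skelDist_skelPush ξ ê hli 𝔖 F, hHT _ hsupp]
    have hΦ := hcv fun y => H (eRealPt (L (y - pbase ξ))) * F y
    have hlhs : (fun U => H (eRealPt (L (posAff ξ ê hli U - pbase ξ))) * F (posAff ξ ê hli U)) =
        fun U => H (eRealPt U) * skelPush ξ ê hli F U := by
      funext U
      rw [skelPush_apply, posAff, add_sub_cancel_left, hL]
      erw [(posLinCLE ê hli).symm_apply_apply U]
    rw [hlhs] at hΦ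
    rw [hΦ, ← integral_const_mul]
    refine integral_congr_ae (Eventually.of_forall fun y => ?_)
    simp only
    rw [← cfgPt_sub, cplxL_cfgPt, mul_assoc]

end Main

/-! ### Patching the local densities: a real-analytic function on the ordered region -/

section Global

variable {n : ℕ}

/-- **Continuous densities of the same distribution agree**: two functions continuous on an open set
`U` of configurations which represent the same functional on the test functions supported in `U`
coincide on `U`. [folklore] -/
theorem eqOn_of_forall_integral_mul_eq {U : Set (Fin n → EuclideanSpace ℝ (Fin d))} (hU : IsOpen U)
    {f g : (Fin n → EuclideanSpace ℝ (Fin d)) → ℂ} (hf : ContinuousOn f U) (hg : ContinuousOn g U)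
    (h : ∀ F : 𝓢((Fin n → EuclideanSpace ℝ (Fin d)), ℂ),
      tsupport (F : (Fin n → EuclideanSpace ℝ (Fin d)) → ℂ) ⊆ U →
        HasCompactSupport (F : (Fin n → EuclideanSpace ℝ (Fin d)) → ℂ) → ∫ y, f y * F y = ∫ y, g y * F y) :
    EqOn f g U := by
  have hint : ∀ {e : (Fin n → EuclideanSpace ℝ (Fin d)) → ℂ}, ContinuousOn e U →
      ∀ F : 𝓢((Fin n → EuclideanSpace ℝ (Fin d)), ℂ), tsupport (F : (Fin n → EuclideanSpace ℝ (Fin d)) → ℂ) ⊆ U →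
        HasCompactSupport (F : (Fin n → EuclideanSpace ℝ (Fin d)) → ℂ) → Integrable fun y => e y * F y :=
    fun he F hF hFc => (continuous_mul_of_continuousOn_of_tsupport_subset hU he F.continuous hF).integrable_of_hasCompactSupport
      hFc.mul_left
  have hae : ∀ᵐ y ∂(volume : Measure (Fin n → EuclideanSpace ℝ (Fin d))), y ∈ U → (f - g) y = 0 := by
    refine hU.ae_eq_zero_of_integral_contDiff_smul_eq_zero ((hf.sub hg).locallyIntegrableOn hU.measurableSet) ?_
    intro g₀ hg₀ hg₀c hg₀U
    have hGC : ContDiff ℝ (⊤ : ℕ∞) (fun y => (g₀ y : ℂ)) := Complex.ofRealCLM.contDiff.comp hg₀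
    have hGc : HasCompactSupport (fun y => (g₀ y : ℂ)) := hg₀c.comp_left Complex.ofReal_zero
    set F : 𝓢((Fin n → EuclideanSpace ℝ (Fin d)), ℂ) := hGc.toSchwartzMap hGC with hFdef
    have hF_apply : ∀ y, F y = (g₀ y : ℂ) := fun y => rfl
    have hFsupp : tsupport (F : (Fin n → EuclideanSpace ℝ (Fin d)) → ℂ) ⊆ U := by
      rw [show (F : (Fin n → EuclideanSpace ℝ (Fin d)) → ℂ) = Complex.ofReal ∘ g₀ from funext hF_apply]
      exact (closure_mono (Function.support_comp_subset Complex.ofReal_zero g₀)).trans hg₀U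
    have hFc : HasCompactSupport (F : (Fin n → EuclideanSpace ℝ (Fin d)) → ℂ) := by
      rw [show (F : (Fin n → EuclideanSpace ℝ (Fin d)) → ℂ) = Complex.ofReal ∘ g₀ from funext hF_apply]
      exact hGc
    have h1 := h F hFsupp hFc
    calc ∫ y, g₀ y • (f - g) y = ∫ y, (f y * F y - g y * F y) := by
          refine integral_congr_ae (Eventually.of_forall fun y => ?_)
          simp only [Pi.sub_apply, hF_apply, Complex.real_smul]
          ring
      _ = 0 := by rw [integral_sub (hint hf F hFsupp hFc) (hint hg F hFsupp hFc), h1, sub_self]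
  have hae' : f =ᵐ[(volume : Measure (Fin n → EuclideanSpace ℝ (Fin d))).restrict U] g := by
    rw [Filter.EventuallyEq, ae_restrict_iff' hU.measurableSet]
    exact hae.mono fun y hy hyU => sub_eq_zero.1 (hy hyU)
  exact Measure.eqOn_open_of_ae_eq hae' hU hf hg

variable [NeZero d] {k : ℕ}

omit [NeZero d] in
/-- **The ordered region** `{x | x⁰_0 < x⁰_1 < ⋯ < x⁰_{k+1}}` of configurations of `k + 2` points. [cite: OsterwalderSchraderCMP1975, §IV.1] -/
def orderedRegion (k d : ℕ) [NeZero d] : Set (Fin (k + 2) → EuclideanSpace ℝ (Fin d)) :=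
  {x | ∀ i : Fin (k + 1), x (Fin.castSucc i) 0 < x i.succ 0}

/-- The ordered region is open. [folklore] -/
theorem isOpen_orderedRegion : IsOpen (orderedRegion k d) := by
  have h : orderedRegion k d = ⋂ i : Fin (k + 1), {x : Fin (k + 2) → EuclideanSpace ℝ (Fin d) | x (Fin.castSucc i) 0 < x i.succ 0} := by
    ext x; simp only [orderedRegion, mem_setOf_eq, mem_iInter]
  rw [h]
  refine isOpen_iInter_of_finite fun i => isOpen_lt ?_ ?_
  · exact (PiLp.continuous_apply 2 _ (0 : Fin d)).comp (continuous_apply (Fin.castSucc i))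
  · exact (PiLp.continuous_apply 2 _ (0 : Fin d)).comp (continuous_apply i.succ)

/-- **Osterwalder–Schrader II, Theorem 4.1 (E): the Schwinger functions are real analytic functions
on the ordered region.** For a Schwinger family with E0', E1, E2 there is a function `S` on the
configurations of `k + 2` points, continuous on the ordered region `{x⁰_0 < ⋯ < x⁰_{k+1}}`, which
near every point `x` of the region is the restriction of a function holomorphic on a complex ball
about `x`, and which is the density of `𝔖_{k+2}` there: `𝔖_{k+2}(F) = ∫ S(y) F(y) dy` for every
test function `F` supported in the ball. [cite: OsterwalderSchraderCMP1975, Thm. 4.1] -/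
theorem schwinger_exists_realAnalytic_density (𝔖 : SchwingerFamily (EuclideanSpace ℝ (Fin d)))
    (hE1 : 𝔖.IsEuclideanCovariant) (hE2 : 𝔖.IsOSReflectionPositive) (hE0 : 𝔖.HasLinearGrowth) :
    ∃ S : (Fin (k + 2) → EuclideanSpace ℝ (Fin d)) → ℂ, ContinuousOn S (orderedRegion k d) ∧
      ∀ x ∈ orderedRegion k d, ∃ ρ : ℝ, 0 < ρ ∧ Metric.ball x ρ ⊆ orderedRegion k d ∧
        ∃ Sc : (Fin (k + 2) → Fin d → ℂ) → ℂ, DifferentiableOn ℂ Sc (ball (cfgPt x) ρ) ∧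
          (∀ y ∈ Metric.ball x ρ, Sc (cfgPt y) = S y) ∧
          ∀ F : 𝓢((Fin (k + 2) → EuclideanSpace ℝ (Fin d)), ℂ),
            tsupport (F : (Fin (k + 2) → EuclideanSpace ℝ (Fin d)) → ℂ) ⊆ Metric.ball x ρ →
              𝔖 (k + 2) F = ∫ y, S y * F y := by
  classical
  -- local data at every point of the region, with balls inside the region
  have hloc : ∀ x ∈ orderedRegion k d, ∃ ρ : ℝ, 0 < ρ ∧ Metric.ball x ρ ⊆ orderedRegion k d ∧
      ∃ Sc : (Fin (k + 2) → Fin d → ℂ) → ℂ, DifferentiableOn ℂ Sc (ball (cfgPt x) ρ) ∧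
        ∀ F : 𝓢((Fin (k + 2) → EuclideanSpace ℝ (Fin d)), ℂ),
          tsupport (F : (Fin (k + 2) → EuclideanSpace ℝ (Fin d)) → ℂ) ⊆ Metric.ball x ρ →
            𝔖 (k + 2) F = ∫ y, Sc (cfgPt y) * F y := by
    intro x hx
    obtain ⟨ρ, hρ, Sc, hSc, -, hrep⟩ := schwinger_exists_holomorphic_density_near 𝔖 hE1 hE2 hE0 x hx
    obtain ⟨ε, hε, hεU⟩ := Metric.isOpen_iff.1 isOpen_orderedRegion x hx
    refine ⟨min ρ ε, lt_min hρ hε, (Metric.ball_subset_ball (min_le_right _ _)).trans hεU, Sc,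
      hSc.mono (ball_subset_ball (min_le_left _ _)), fun F hF => hrep F (hF.trans (Metric.ball_subset_ball (min_le_left _ _)))⟩
  choose! ρ hρ hρU Sc hSc hrep using hloc
  have hcontSc : ∀ x ∈ orderedRegion k d, ContinuousOn (fun y => Sc x (cfgPt y)) (Metric.ball x (ρ x)) := fun x hx =>
    (hSc x hx).continuousOn.comp continuous_cfgPt.continuousOn fun y hy => cfgPt_mem_ball hy
  -- consistency of the charts: on overlapping balls the densities agree
  have hcons : ∀ x ∈ orderedRegion k d, ∀ y ∈ Metric.ball x (ρ x), Sc x (cfgPt y) = Sc y (cfgPt y) := by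
    intro x hx y hy
    have hyU : y ∈ orderedRegion k d := hρU x hx hy
    have hW : IsOpen (Metric.ball x (ρ x) ∩ Metric.ball y (ρ y)) := isOpen_ball.inter isOpen_ball
    have hyW : y ∈ Metric.ball x (ρ x) ∩ Metric.ball y (ρ y) := ⟨hy, mem_ball_self (hρ y hyU)⟩
    have heq := eqOn_of_forall_integral_mul_eq hW ((hcontSc x hx).mono inter_subset_left)
      ((hcontSc y hyU).mono inter_subset_right) fun F hF _ => by
        rw [← hrep x hx F (hF.trans inter_subset_left), ← hrep y hyU F (hF.trans inter_subset_right)]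
    exact heq hyW
  -- the patched function
  refine ⟨fun y => Sc y (cfgPt y), fun x hx => ?_, fun x hx => ⟨ρ x, hρ x hx, hρU x hx, Sc x, hSc x hx,
    fun y hy => hcons x hx y hy, fun F hF => ?_⟩⟩
  · -- continuity: near `x` the function is `Sc x ∘ cfgPt`
    have h := (hcontSc x hx).congr fun y hy => (hcons x hx y hy).symm
    exact (h.continuousAt (isOpen_ball.mem_nhds (mem_ball_self (hρ x hx)))).continuousWithinAt
  · -- representation
    rw [hrep x hx F hF]
    refine integral_congr_ae (Eventually.of_forall fun y => ?_)
    by_cases hy : y ∈ tsupport (F : (Fin (k + 2) → EuclideanSpace ℝ (Fin d)) → ℂ)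
    · simp only
      rw [hcons x hx y (hF hy)]
    · simp only [image_eq_zero_of_notMem_tsupport hy, mul_zero]

end Global

section OSFamily

variable [NeZero d]

/-- **Osterwalder–Schrader II, Theorem 4.1 (E), pointwise form, for an OS family with E0'** (the
hypotheses of the reconstruction theorem E' ⇒ R'). [cite: OsterwalderSchraderCMP1975, Thm. 4.1] -/
theorem schwinger_exists_holomorphic_density_near_of_isOSFamily (𝔖 : SchwingerFamily (EuclideanSpace ℝ (Fin d)))
    (hOS : 𝔖.IsOSFamily) (hE0 : 𝔖.HasLinearGrowth) {k : ℕ} (x : Fin (k + 2) → EuclideanSpace ℝ (Fin d))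
    (hx : ∀ i : Fin (k + 1), x (Fin.castSucc i) 0 < x i.succ 0) :
    ∃ ρ : ℝ, 0 < ρ ∧ ∃ S : (Fin (k + 2) → Fin d → ℂ) → ℂ,
      DifferentiableOn ℂ S (ball (cfgPt x) ρ) ∧ (∃ B : ℝ, ∀ ζ ∈ ball (cfgPt x) ρ, ‖S ζ‖ ≤ B) ∧
      ∀ F : 𝓢((Fin (k + 2) → EuclideanSpace ℝ (Fin d)), ℂ),
        tsupport (F : (Fin (k + 2) → EuclideanSpace ℝ (Fin d)) → ℂ) ⊆ Metric.ball x ρ →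
          𝔖 (k + 2) F = ∫ y, S (cfgPt y) * F y :=
  schwinger_exists_holomorphic_density_near 𝔖 hOS.covariant hOS.reflectionPositive hE0 x hx

end OSFamily

end Literature.MathematicalPhysics.QuantumFieldTheory
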